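import Mathlib
import Summits.Ventures.PercRepro.PuncturedLYMMixP1Q1Table1

/-!
# PercRepro — (SP) FOR `1` PAIRWISE DISJOINT PAIRS AND `1` PAIRWISE DISJOINT QUADRUPLES AT LEVEL `4`: POSITIVITY OF THE DENOMINATORS (1)
(p10, gen 41)

`den > 0`, `Pc > 0` for `n ≥ 6`; `Yc > 0` for `n ≥ 5`.  Nothing here asserts (SP).
-/

namespace PercRepro.PuncturedLYM.Split.TypeLift.MixP1Q1

/-- `den > 0` for `n ≥ 6`. -/
theorem den_pos (n : ℚ) (hn : 6 ≤ n) : 0 < den n := by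
  obtain ⟨n', hn', rfl⟩ : ∃ n', 0 ≤ n' ∧ n = 6 + n' := ⟨n - 6, by linarith, by ring⟩
  have h : den (6 + n') = 288 * n' ^ 7 + 10416 * n' ^ 6 + 156480 * n' ^ 5 + 1264704 * n' ^ 4 + 5922624 * n' ^ 3 + 15954192 * n' ^ 2 + 22504032 * n' + 12248064 := by unfold den; ring
  rw [h]; positivity

/-- `Yc > 0` for `n ≥ 5`. -/
theorem Yc_pos (n : ℚ) (hn : 5 ≤ n) : 0 < Yc n := by
  obtain ⟨n', hn', rfl⟩ : ∃ n', 0 ≤ n' ∧ n = 5 + n' := ⟨n - 5, by linarith, by ring⟩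
  have h : Yc (5 + n') = (1 / 120) * n' ^ 5 + (1 / 8) * n' ^ 4 + (17 / 24) * n' ^ 3 + (15 / 8) * n' ^ 2 + (137 / 60) * n' + 1 := by unfold Yc; ring
  rw [h]; positivity

/-- `Pc > 0` for `n ≥ 6`. -/
theorem Pc_pos (n : ℚ) (hn : 6 ≤ n) : 0 < Pc n := by
  obtain ⟨n', hn', rfl⟩ : ∃ n', 0 ≤ n' ∧ n = 6 + n' := ⟨n - 6, by linarith, by ring⟩
  have h : Pc (6 + n') = (1 / 24) * n' ^ 4 + (3 / 4) * n' ^ 3 + (107 / 24) * n' ^ 2 + (43 / 4) * n' + 8 := by unfold Pc; ring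
  rw [h]; positivity

end PercRepro.PuncturedLYM.Split.TypeLift.MixP1Q1
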